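import Summits.FinalStateConjecture.FinalStateConjecture.Theorems.ClusterCompletenessRecurrentlyFlatDispersesRestart

/-!
# Crux `RecurrentlyFlatDisperses` (stmt-FinalStateConjecture-14665), line `Sketch` — CONVERGENT
# CASE: `stub_decomp` holds for every anchored chart whose `C²` deviation converges

Continuation lead c5, 2026-08-16 (brick on the `stub_decomp` side). The open half `stub_decomp` of
skeleton v8 asks: an anchored flat late chart `Ψ₀ : U₀ → 𝒟` of a maximal vacuum Cauchy development
of admissible data (the five conjuncts `Hyp`, verbatim) on which `Cᵏ`-flatness RECURS
(`∀ ε > 0, ∃ᶠ τ, deviationCk … Ψ₀ k τ ≤ ε`) gives the Statement's settling conclusion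
`∃ O' (d : FinalStateDecomposition 𝒟.toSpacetime O' 2), subextremal ∧ O' = exteriorOf 𝒟 d.charted ∧
HasExhaustiveCharts d`. This file isolates its open content:

* `decomp_of_convergentChart` — the decomposition half of the landed packaging
  `stub_settlesOfScriCapture` ALONE (that theorem bundles it with complete `𝓘⁺`, which in the v8
  split is the other half's conclusion and may not be assumed here): a convergent (`C²`) anchored
  flat late chart `Φ : U₁ → 𝒟`, `{x⁰ > τ₁} ⊆ U₁`, into its self-determined exterior, exhausting it
  at every `τ ≥ τ₁`, gives the `N = 0` decomposition with exhaustive charts;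
* `decomp_of_tendsto` — **`stub_decomp` with recurrence strengthened to convergence**: under `Hyp`,
  if `deviationCk … Ψ₀ 2 τ → 0` then the settling conclusion holds, with `Φ = Ψ₀` restarted at
  `τ₁ = τ₀ + 1` by the landed `hyp_of_lt` (the exhaustion at `τ₁` itself is the crux's fourth
  conjunct through `exteriorOf 𝒟 (Ψ₀{x⁰ > τ₁}) ⊆ O`, `Restart.exteriorOf_mono`).

Hence the irreducible content of `stub_decomp` is exactly the upgrade
`Hyp ∧ Recurs k ⟹ ∃ (τ₁, U₁, Φ) anchored with Tendsto (deviationCk … Φ 2) atTop (𝓝 0)` (for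
`Φ = Ψ₀`: recurrence ⟹ convergence of the given foliation), i.e. Minkowski stability from recurrent
unweighted slab flatness. Mathlib + the Statement cone + landed bricks only; no definitions, no
named facts.
-/

noncomputable section

open scoped Manifold ContDiff Topology
open Filter Set TopologicalSpace Literature.Geometry.Lorentzian

namespace Summit.FinalStateConjecture.FinalStateConjecture.Theorems.RecurrentlyFlatDisperses

/-- **A convergent anchored flat chart settles the development (decomposition half only).** A
convergent (`C²`) anchored flat late chart `Φ : U₁ → 𝒟` on a late half-space `{x⁰ > τ₁} ⊆ U₁`,
which is a late chart into its self-determined exterior `O₁ = J⁺(Σ) ∩ I⁻(Φ{x⁰ > τ₁})` and exhausts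
it at every chart time `τ ≥ τ₁`, gives an exhaustive sub-extremal (vacuously: no holes) `N = 0`
final-state decomposition `d` of `O₁ = exteriorOf 𝒟 d.charted` (Dafermos–Luk 2017, Conjecture 1,
the `N = 0` case of the final-state picture). The construction is that of the landed
`stub_settlesOfScriCapture`, minus its `𝓘⁺` conjunct. -/
theorem decomp_of_convergentChart :
    ∀ (X : Type) [TopologicalSpace X] [ChartedSpace E3 X] [IsManifold (𝓡 3) ∞ X] [T2Space X]
      [SecondCountableTopology X] [ConnectedSpace X] (D : InitialDataSet (𝓡 3) X)
      (𝒟 : VacuumCauchyDevelopment D),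
        (∃ (τ₁ : ℝ) (U₁ : Opens E4) (Φ : U₁ → 𝒟.carrier),
            {x : E4 | τ₁ < x 0} ⊆ (U₁ : Set E4) ∧
            𝒟.toSpacetime.IsLateChart (Minkowski.backgroundOn U₁)
              (Summit.FinalStateConjecture.exteriorOf 𝒟.toCauchyDevelopment
                (Φ '' (Minkowski.backgroundOn U₁).lateRegion τ₁)) τ₁ Φ ∧
            Tendsto (fun τ ↦ 𝒟.toSpacetime.deviationCk (Minkowski.backgroundOn U₁) Φ 2 τ)
              atTop (𝓝 0) ∧
            (∀ τ : ℝ, τ₁ ≤ τ →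
              Summit.FinalStateConjecture.exteriorOf 𝒟.toCauchyDevelopment
                  (Φ '' (Minkowski.backgroundOn U₁).lateRegion τ₁) \
                    Φ '' (Minkowski.backgroundOn U₁).lateRegion τ ⊆
                𝒟.metric.causalPast 𝒟.timeOrientation
                  (Φ '' (Minkowski.backgroundOn U₁).timeSlab τ))) →
        ∃ (O : Set 𝒟.carrier) (d : FinalStateDecomposition 𝒟.toSpacetime O 2),
          (∀ i, Kerr.IsSubextremal (d.mass i) (d.spin i)) ∧
            O = Summit.FinalStateConjecture.exteriorOf 𝒟.toCauchyDevelopment d.charted ∧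
              Summit.FinalStateConjecture.HasExhaustiveCharts d := by
  -- copied from `Summits/FinalStateConjecture/FinalStateConjecture/Theorems/
  --   ClusterCompletenessRecurrentlyFlatDispersesStubSettlesOfScriCapture.lean`, part (b)
  intro X _ _ _ _ _ _ D 𝒟 h
  obtain ⟨τ₁, U₁, Φ, hU, hlate, hdev, hexh⟩ := h
  -- the `N = 0` decomposition of the self-determined exterior of the flat chart
  let O' : Set 𝒟.carrier := Summit.FinalStateConjecture.exteriorOf 𝒟.toCauchyDevelopment
    (Φ '' (Minkowski.backgroundOn U₁).lateRegion τ₁)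
  let d : FinalStateDecomposition 𝒟.toSpacetime O' 2 :=
    { N := 0
      mass := Fin.elim0
      spin := Fin.elim0
      mass_pos := fun i ↦ i.elim0
      abs_spin_le_mass := fun i ↦ i.elim0
      motion := Fin.elim0
      τ₀ := τ₁
      chart := fun i ↦ i.elim0
      isLateChart := fun i ↦ i.elim0
      tendsto_truncDeviationCk := fun i ↦ i.elim0
      exists_pairwise_disjoint := fun _ ↦ ⟨0, fun i ↦ i.elim0⟩
      excision := Fin.elim0
      tendsto_excision_div := fun i ↦ i.elim0
      flatDomain := U₁
      setOf_lt_excision_subset_flatDomain := fun x hx ↦ hU hx.1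
      flatChart := Φ
      isLateChart_flat := hlate
      tendsto_deviationCk_flat := hdev
      diff_subset_causalPast := by
        intro p hp
        have hp2 : p ∉ Φ '' (Minkowski.backgroundOn U₁).lateRegion τ₁ :=
          fun h' ↦ hp.2 (Or.inr h')
        have hJ := hexh τ₁ le_rfl ⟨hp.1, hp2⟩
        exact LorentzianMetric.causalFuture_mono subset_union_right hJ }
  refine ⟨O', d, fun i ↦ i.elim0, ?_,
    ⟨fun i ↦ i.elim0, fun i ↦ i.elim0, fun i ↦ i.elim0, fun τ hτ ↦ ?_⟩⟩
  · -- `O' = J⁺(ι X) ∩ I⁻(d.charted)`, as `d.charted = Φ '' {x⁰ > τ₁} ∪ ⋃ (over Fin 0)`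
    have hch : d.charted = Φ '' (Minkowski.backgroundOn U₁).lateRegion τ₁ := by
      ext p
      simp only [FinalStateDecomposition.charted, Set.mem_union, Set.mem_iUnion]
      constructor
      · rintro (h' | ⟨i, -⟩)
        · exact h'
        · exact i.elim0
      · exact fun h' ↦ Or.inl h'
    rw [hch]
  · -- exhaustion at chart time `τ > τ₁`: the certified pieces are the flat ones
    intro p hp
    have hp2 : p ∉ Φ '' (Minkowski.backgroundOn U₁).lateRegion τ := fun h' ↦ hp.2 (Or.inl h')
    have hJ := hexh τ (le_of_lt hτ) ⟨hp.1, hp2⟩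
    exact LorentzianMetric.causalFuture_mono subset_union_left hJ

/-- **`stub_decomp` in the convergent case** (crux stmt-FinalStateConjecture-14665, line `Sketch`;
hypotheses = the crux's anchored conjuncts verbatim, conclusion = the stub's verbatim). If the
anchored flat late chart `Ψ₀ : U₀ → 𝒟` of a maximal vacuum Cauchy development of admissible data
has `C²` deviation CONVERGING to `0` along its entire late slabs (instead of merely recurring below
every `ε`), then the development settles in the sense of the Statement: restart `Ψ₀` at
`τ₁ = τ₀ + 1` (landed `hyp_of_lt`), supply the exhaustion at `τ₁` itself from the crux's fourth
conjunct through `exteriorOf 𝒟 (Ψ₀{x⁰ > τ₁}) ⊆ O` (`Restart.exteriorOf_mono`), and package with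
`decomp_of_convergentChart` (Dafermos–Luk 2017, Conjecture 1, `N = 0`). -/
theorem decomp_of_tendsto :
    ∀ (X : Type) [TopologicalSpace X] [ChartedSpace E3 X] [IsManifold (𝓡 3) ∞ X] [T2Space X]
      [SecondCountableTopology X] [ConnectedSpace X],
      ∀ D ∈ admissibleVacuumData X, ∀ 𝒟 : VacuumCauchyDevelopment D, 𝒟.IsMaximal →
        ∀ (O : Set 𝒟.carrier) (τ₀ : ℝ) (U₀ : Opens E4) (Ψ₀ : U₀ → 𝒟.carrier),
          (𝒟.toSpacetime.IsLateChart (Minkowski.backgroundOn U₀) O τ₀ Ψ₀ ∧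
            {x : E4 | τ₀ < x 0} ⊆ (U₀ : Set E4) ∧
            O = Summit.FinalStateConjecture.exteriorOf 𝒟.toCauchyDevelopment
              (Ψ₀ '' (Minkowski.backgroundOn U₀).lateRegion τ₀) ∧
            (∀ τ₁ : ℝ, τ₀ < τ₁ → O \ Ψ₀ '' (Minkowski.backgroundOn U₀).lateRegion τ₁ ⊆
              𝒟.metric.causalPast 𝒟.timeOrientation
                (Ψ₀ '' (Minkowski.backgroundOn U₀).timeSlab τ₁)) ∧
            (∀ τ : ℝ, τ₀ < τ → 𝒟.toSpacetime.deviationCk (Minkowski.backgroundOn U₀) Ψ₀ 0 τ ≤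
              ENNReal.ofReal (1 / 4))) →
          Tendsto (fun τ ↦ 𝒟.toSpacetime.deviationCk (Minkowski.backgroundOn U₀) Ψ₀ 2 τ)
            atTop (𝓝 0) →
          ∃ (O' : Set 𝒟.carrier) (d : FinalStateDecomposition 𝒟.toSpacetime O' 2),
            (∀ i, Kerr.IsSubextremal (d.mass i) (d.spin i)) ∧
              O' = Summit.FinalStateConjecture.exteriorOf 𝒟.toCauchyDevelopment d.charted ∧
                Summit.FinalStateConjecture.HasExhaustiveCharts d := by
  intro X _ _ _ _ _ _ D hD 𝒟 hmax O τ₀ U₀ Ψ₀ hyp hconv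
  -- restart the anchored chart at `τ₁ = τ₀ + 1`
  obtain ⟨hlate, hU₁, -, hexh₁, -⟩ :=
    hyp_of_lt X D hD 𝒟 hmax O τ₀ U₀ Ψ₀ hyp (τ₀ + 1) (lt_add_one τ₀)
  obtain ⟨-, -, hO, hexh, -⟩ := hyp
  refine decomp_of_convergentChart X D 𝒟 ⟨τ₀ + 1, U₀, Ψ₀, hU₁, hlate, hconv, fun τ hτ ↦ ?_⟩
  rcases hτ.eq_or_lt with rfl | hlt
  · -- at `τ₁` itself: `exteriorOf 𝒟 W_{τ₁} \ W_{τ₁} ⊆ O \ W_{τ₁} ⊆ J⁻(S_{τ₁})`, as `τ₁ > τ₀`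
    intro p hp
    refine hexh (τ₀ + 1) (lt_add_one τ₀) ⟨?_, hp.2⟩
    rw [hO]
    exact Restart.exteriorOf_mono 𝒟.toCauchyDevelopment
      (image_mono ((Minkowski.backgroundOn U₀).lateRegion_mono (lt_add_one τ₀).le)) hp.1
  · exact hexh₁ τ hlt

end Summit.FinalStateConjecture.FinalStateConjecture.Theorems.RecurrentlyFlatDisperses

end
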